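import Literature.Analysis.Potential.CircleLogKernel
import HarnessLib

/-!
# The logarithmic potential of the arcsine law (equilibrium potential of a segment)

Topic `Analysis/Potential`, namespace `Literature.Analysis.Potential`. For `a > 0`, the arcsine
(equilibrium) distribution of the segment `[-a, a]`, `dμ(y) = dy/(π√(a² - y²))`, is the image of
the uniform probability on `[-π, π]` under `β ↦ a cos β`; its logarithmic potential
`U(x) = ∫ log|x - y| dμ(y) = (2π)⁻¹ ∫_{-π}^{π} log |x - a cos β| dβ` is CONSTANT `= log (a/2)` on the
segment and `= log ((|x| + √(x² - a²))/2)` outside (Ransford, *Potential Theory in the Complex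
Plane*, §3.3–3.4; Saff–Totik, *Logarithmic Potentials with External Fields*, I.1 Example 1.3 /
I.3 (3.8): the equilibrium measure of `[-1, 1]` is the arcsine law, of capacity `1/2`). PROVED here
from the tree's circle kernel `ℓ(v) = log |1 - e^{iv}|` (`CircleLogKernel.lean`: `∫_{-π}^{π} ℓ = 0`,
`ℓ(x - β) + ℓ(x + β) = log (2|cos x - cos β|)`, and the Joukowski form
`log ((ρ + ρ⁻¹)/2 + cos β) = 2 ℓ_ρ(β + π) - log (2ρ)` with `∫ ℓ_ρ = 0`):

* `integral_log_abs_cos_sub_cos` — `∫_{-π}^{π} log |cos x - cos β| dβ = -2π log 2` for every real `x`;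
* `integral_log_abs_sub_mul_cos_of_abs_le` — `∫_{-π}^{π} log |x - a cos β| dβ = 2π log (a/2)`,
  `|x| ≤ a`;
* `integral_log_abs_sub_mul_cos_of_lt_abs` — `= 2π log ((|x| + √(x² - a²))/2)`, `a < |x|`, and the
  uniform lower bound `twoPi_mul_log_half_le_integral_log_abs_sub_mul_cos` (`≥ 2π log (a/2)` for all `x`);
* the same statements in the distribution-function parametrisation `y = a sin (π s/2)`,
  `s ∈ [-1, 1]` (`ds` = twice the arcsine measure):
  `∫_{-1}^{1} log |x - a sin (π s/2)| ds = 2 log (a/2)` on the segment, `≥ 2 log (a/2)` everywhere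
  (`integral_log_abs_sub_mul_sin`, `two_mul_log_half_le_integral_log_abs_sub_mul_sin`) — the form in
  which the potential of the Logan–Shepp–Vershik–Kerov limit shape `Ω_N`
  (`Ω_N'(y) = (2/π) arcsin (y/(2√N))`, so `Ω_N'' dy = ds` with `a = 2√N`) enters the Vershik–Kerov
  expansion of the hook integral (`Literature/RepresentationTheory/FiniteGroups/VershikKerov*`).

## References

* T. Ransford, *Potential Theory in the Complex Plane*, LMS Student Texts 28 (1995), §3.3–3.4.
* E. B. Saff, V. Totik, *Logarithmic Potentials with External Fields* (1997), §I.1, §I.3.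
* A. M. Vershik, S. V. Kerov, Funct. Anal. Appl. 19 (1985) 21–31 (the use for the limit shape of
  Young diagrams). [VershikKerov1985]

## Mathlib and tree

Mathlib: `Real.cos_eq_cos_iff`, `Real.cos_arccos`, `Set.Countable.ae_notMem`,
`intervalIntegral.integral_congr_ae`, `intervalIntegral.integral_comp_mul_add`,
`intervalIntegral.integral_comp_neg`. Tree (`CircleLogKernel.lean`): `circleLogKernel`,
`circleLogKernelR`, `circleLogKernel_sub_add_circleLogKernel_add`, `log_joukowski_add_cos`,
`integral_circleLogKernel_sub_mul`, `integral_circleLogKernelR`, `periodic_circleLogKernelR`,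
`intervalIntegrable_circleLogKernel_sub(')`. Theorems only; no new definitions.
-/

noncomputable section

open _root_.MeasureTheory _root_.Filter _root_.Set intervalIntegral
open scoped Real Interval

namespace Literature.Analysis.Potential

/-! ### `∫ log |cos x - cos β| dβ = -2π log 2` -/

/-- The set `{β | cos β = cos x} = (x + 2πℤ) ∪ (-x + 2πℤ)` is countable. [folklore] -/
theorem countable_setOf_cos_eq (x : ℝ) : {β : ℝ | Real.cos β = Real.cos x}.Countable := by
  have hsub : {β : ℝ | Real.cos β = Real.cos x} ⊆
      Set.range (fun k : ℤ => 2 * k * π + x) ∪ Set.range (fun k : ℤ => 2 * k * π - x) := by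
    intro β hβ
    obtain ⟨k, hk | hk⟩ := Real.cos_eq_cos_iff.mp (hβ : Real.cos β = Real.cos x).symm
    · exact Or.inl ⟨k, hk.symm⟩
    · exact Or.inr ⟨k, hk.symm⟩
  exact ((Set.countable_range _).union (Set.countable_range _)).mono hsub

/-- Lebesgue-a.e. `β` has `cos β ≠ cos x`. [folklore] -/
theorem ae_cos_ne_cos (x : ℝ) : ∀ᵐ β : ℝ, Real.cos β ≠ Real.cos x :=
  (countable_setOf_cos_eq x).ae_notMem volume

/-- For a.e. `β`: `log |cos x - cos β| = ℓ(x - β) + ℓ(x + β) - log 2`. [folklore] -/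
theorem ae_log_abs_cos_sub_cos_eq (x : ℝ) : ∀ᵐ β : ℝ,
    Real.log |Real.cos x - Real.cos β| =
      circleLogKernel (x - β) + circleLogKernel (x + β) - Real.log 2 := by
  filter_upwards [ae_cos_ne_cos x] with β hβ
  rw [circleLogKernel_sub_add_circleLogKernel_add (Ne.symm hβ),
    Real.log_mul two_ne_zero (abs_ne_zero.mpr (sub_ne_zero.mpr (Ne.symm hβ)))]
  ring

/-- `β ↦ ℓ(x + β)` is integrable on bounded intervals. [folklore] -/
theorem intervalIntegrable_circleLogKernel_add (x a b : ℝ) :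
    IntervalIntegrable (fun β => circleLogKernel (x + β)) volume a b :=
  (intervalIntegrable_circleLogKernel_sub (-x) a b).congr fun β _ => by
    show circleLogKernel (β - -x) = circleLogKernel (x + β)
    rw [sub_neg_eq_add, add_comm]

/-- `β ↦ log |cos x - cos β|` is integrable on bounded intervals. [folklore] -/
theorem intervalIntegrable_log_abs_cos_sub_cos (x a b : ℝ) :
    IntervalIntegrable (fun β => Real.log |Real.cos x - Real.cos β|) volume a b :=
  (((intervalIntegrable_circleLogKernel_sub' x a b).add
    (intervalIntegrable_circleLogKernel_add x a b)).sub
      (intervalIntegrable_const (c := Real.log 2))).congr_ae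
        (ae_restrict_of_ae ((ae_log_abs_cos_sub_cos_eq x).mono fun _ hβ => hβ.symm))

/-- `∫_{-π}^{π} ℓ(x - β) dβ = 0`. [folklore] -/
theorem integral_circleLogKernel_sub_eq_zero (x : ℝ) :
    ∫ β in (-π)..π, circleLogKernel (x - β) = 0 := by
  have h := integral_circleLogKernel_sub_mul x 1 0
  simp only [zero_mul, add_zero, mul_one, mul_zero] at h
  simpa using h

/-- `∫_{-π}^{π} ℓ(x + β) dβ = 0`. [folklore] -/
theorem integral_circleLogKernel_add_eq_zero (x : ℝ) :
    ∫ β in (-π)..π, circleLogKernel (x + β) = 0 := by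
  have h := integral_circleLogKernel_sub_eq_zero (-x)
  have he : ∀ β, circleLogKernel (-x - β) = circleLogKernel (x + β) := fun β => by
    rw [show -x - β = -(x + β) by ring, circleLogKernel_neg]
  simp_rw [he] at h
  exact h

/-- **`∫_{-π}^{π} log |cos x - cos β| dβ = -2π log 2`** for every real `x` (the mean of
`log |e^{ix} - e^{iβ}| + log |e^{ix} - e^{-iβ}| = log (2 |cos x - cos β|)` vanishes). [folklore] -/
theorem integral_log_abs_cos_sub_cos (x : ℝ) :
    ∫ β in (-π)..π, Real.log |Real.cos x - Real.cos β| = -2 * π * Real.log 2 := by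
  have hae : ∀ᵐ β : ℝ, β ∈ Ι (-π) π →
      Real.log |Real.cos x - Real.cos β| =
        circleLogKernel (x - β) + circleLogKernel (x + β) - Real.log 2 :=
    (ae_log_abs_cos_sub_cos_eq x).mono fun β hβ _ => hβ
  rw [intervalIntegral.integral_congr_ae hae,
    intervalIntegral.integral_sub ((intervalIntegrable_circleLogKernel_sub' x _ _).add
      (intervalIntegrable_circleLogKernel_add x _ _)) intervalIntegrable_const,
    intervalIntegral.integral_add (intervalIntegrable_circleLogKernel_sub' x _ _)
      (intervalIntegrable_circleLogKernel_add x _ _),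
    integral_circleLogKernel_sub_eq_zero, integral_circleLogKernel_add_eq_zero,
    intervalIntegral.integral_const, smul_eq_mul]
  ring

/-! ### The potential on the segment -/

/-- For `0 < a` and `|x| ≤ a` there is `φ` with `x = a cos φ`. [folklore] -/
theorem exists_eq_mul_cos {x a : ℝ} (ha : 0 < a) (hx : |x| ≤ a) : ∃ φ : ℝ, x = a * Real.cos φ := by
  refine ⟨Real.arccos (x / a), ?_⟩
  rw [Real.cos_arccos]
  · field_simp
  · rw [le_div_iff₀ ha]; linarith [(abs_le.mp hx).1]
  · rw [div_le_iff₀ ha]; linarith [(abs_le.mp hx).2]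

/-- **Equilibrium potential of a segment, on the segment**: for `0 < a` and `|x| ≤ a`,
`∫_{-π}^{π} log |x - a cos β| dβ = 2π log (a/2)` (`x = a cos φ`; the arcsine law of `[-a, a]` has
constant logarithmic potential `log (a/2)` on the segment — capacity `a/2`). [folklore] -/
theorem integral_log_abs_sub_mul_cos_of_abs_le {x a : ℝ} (ha : 0 < a) (hx : |x| ≤ a) :
    ∫ β in (-π)..π, Real.log |x - a * Real.cos β| = 2 * π * Real.log (a / 2) := by
  obtain ⟨φ, hxa⟩ := exists_eq_mul_cos ha hx
  have hae : ∀ᵐ β : ℝ, β ∈ Ι (-π) π →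
      Real.log |x - a * Real.cos β| = Real.log a + Real.log |Real.cos φ - Real.cos β| := by
    filter_upwards [ae_cos_ne_cos φ] with β hβ _
    rw [hxa, ← mul_sub, abs_mul, abs_of_pos ha,
      Real.log_mul ha.ne' (abs_ne_zero.mpr (sub_ne_zero.mpr (Ne.symm hβ)))]
  rw [intervalIntegral.integral_congr_ae hae,
    intervalIntegral.integral_add intervalIntegrable_const (intervalIntegrable_log_abs_cos_sub_cos φ _ _),
    intervalIntegral.integral_const, integral_log_abs_cos_sub_cos, Real.log_div ha.ne' two_ne_zero,
    smul_eq_mul]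
  ring

/-- Integrability of `β ↦ log |x - a cos β|` on bounded intervals when `|x| ≤ a`, `0 < a`.
[folklore] -/
theorem intervalIntegrable_log_abs_sub_mul_cos_of_abs_le {x a : ℝ} (ha : 0 < a) (hx : |x| ≤ a)
    (c d : ℝ) : IntervalIntegrable (fun β => Real.log |x - a * Real.cos β|) volume c d := by
  obtain ⟨φ, hxa⟩ := exists_eq_mul_cos ha hx
  refine ((intervalIntegrable_const (c := Real.log a)).add
    (intervalIntegrable_log_abs_cos_sub_cos φ c d)).congr_ae (ae_restrict_of_ae ?_)
  filter_upwards [ae_cos_ne_cos φ] with β hβ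
  show Real.log a + Real.log |Real.cos φ - Real.cos β| = Real.log |x - a * Real.cos β|
  rw [hxa, ← mul_sub, abs_mul, abs_of_pos ha,
    Real.log_mul ha.ne' (abs_ne_zero.mpr (sub_ne_zero.mpr (Ne.symm hβ)))]

/-! ### The potential off the segment -/

/-- **Equilibrium potential of a segment, off the segment**: for `0 < a < |x|`,
`∫_{-π}^{π} log |x - a cos β| dβ = 2π log ((|x| + √(x² - a²))/2)` (Joukowski: with
`0 < ρ = (|x| - √(x² - a²))/a < 1`, `|x|/a = (ρ + ρ⁻¹)/2` and `∫ ℓ_ρ = 0`). [folklore] -/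
theorem integral_log_abs_sub_mul_cos_of_lt_abs {x a : ℝ} (ha : 0 < a) (hx : a < |x|) :
    ∫ β in (-π)..π, Real.log |x - a * Real.cos β| =
      2 * π * Real.log ((|x| + Real.sqrt (x ^ 2 - a ^ 2)) / 2) := by
  have hsq0 : 0 < x ^ 2 - a ^ 2 := by nlinarith [sq_abs x, abs_nonneg x]
  set r : ℝ := Real.sqrt (x ^ 2 - a ^ 2) with hr
  have hr0 : 0 < r := Real.sqrt_pos.mpr hsq0
  have hrr : r * r = x ^ 2 - a ^ 2 := Real.mul_self_sqrt hsq0.le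
  have hrx : r < |x| := by nlinarith [sq_abs x]
  -- `ρ = (|x| - r)/a ∈ (0, 1)` with `ρ⁻¹ = (|x| + r)/a`
  set ρ : ℝ := (|x| - r) / a with hρ
  have hρ0 : 0 < ρ := div_pos (by linarith) ha
  have hρinv : ρ⁻¹ = (|x| + r) / a := by
    rw [hρ, inv_div, div_eq_div_iff (by linarith) ha.ne']
    nlinarith [sq_abs x]
  have hρ1 : ρ < 1 := by
    rw [hρ, div_lt_one ha]
    nlinarith [sq_abs x, abs_nonneg x]
  have hC : (ρ + ρ⁻¹) / 2 = |x| / a := by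
    rw [hρinv, hρ]
    field_simp
    ring
  have h2 : (1 : ℝ) < |x| / a := by rw [lt_div_iff₀ ha]; linarith
  -- the shift `η`: `2π` if `x > 0`, `π` if `x < 0`
  set η : ℝ := if 0 ≤ x then 2 * π else π with hη
  have key : ∀ β, Real.log |x - a * Real.cos β| =
      Real.log a + (2 * circleLogKernelR ρ (β + η) - Real.log (2 * ρ)) := by
    intro β
    rw [hη]
    split_ifs with h0
    · -- `x > 0`: `x - a cos β = a ((ρ+ρ⁻¹)/2 + cos (β + π))`
      have h1 : x - a * Real.cos β = a * ((ρ + ρ⁻¹) / 2 + Real.cos (β + π)) := by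
        rw [hC, Real.cos_add_pi, abs_of_nonneg h0]
        field_simp
        ring
      have hpos : 0 < (ρ + ρ⁻¹) / 2 + Real.cos (β + π) := by
        rw [hC, Real.cos_add_pi]
        linarith [Real.cos_le_one β]
      rw [h1, abs_of_pos (mul_pos ha hpos), Real.log_mul ha.ne' hpos.ne',
        log_joukowski_add_cos hρ0 hρ1, show β + π + π = β + 2 * π by ring]
    · -- `x < 0`: `|x - a cos β| = |x| + a cos β = a ((ρ+ρ⁻¹)/2 + cos β)`
      have hxabs : |x| = -x := abs_of_neg (not_le.mp h0)
      have h1 : x - a * Real.cos β = -(a * ((ρ + ρ⁻¹) / 2 + Real.cos β)) := by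
        rw [hC, hxabs]
        field_simp
        ring
      have hpos : 0 < (ρ + ρ⁻¹) / 2 + Real.cos β := by
        rw [hC]
        linarith [Real.neg_one_le_cos β]
      rw [h1, abs_neg, abs_of_pos (mul_pos ha hpos), Real.log_mul ha.ne' hpos.ne',
        log_joukowski_add_cos hρ0 hρ1]
  simp_rw [key]
  have hint : IntervalIntegrable (fun β => circleLogKernelR ρ (β + η)) volume (-π) π := by
    simpa only [sub_neg_eq_add] using intervalIntegrable_circleLogKernelR_sub ρ (-η) (-π) π
  rw [intervalIntegral.integral_add intervalIntegrable_const
      ((hint.const_mul 2).sub intervalIntegrable_const),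
    intervalIntegral.integral_sub (hint.const_mul 2) intervalIntegrable_const,
    intervalIntegral.integral_const_mul, intervalIntegral.integral_comp_add_right,
    intervalIntegral.integral_const, intervalIntegral.integral_const]
  -- `∫ ℓ_ρ` over a shifted period vanishes
  have hzero : ∫ β in (-π + η)..(π + η), circleLogKernelR ρ β = 0 := by
    have h := (periodic_circleLogKernelR ρ).intervalIntegral_add_eq (-π) (-π + η)
    rw [show -π + η + 2 * π = π + η by ring, show -π + 2 * π = π by ring] at h
    rw [← h, integral_circleLogKernelR hρ0.le hρ1]
  rw [hzero, mul_zero, zero_sub, Real.log_mul two_ne_zero hρ0.ne']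
  have hlog : Real.log ((|x| + r) / 2) = Real.log a - Real.log 2 - Real.log ρ := by
    have e1 : Real.log ((|x| + r) / 2) = Real.log (|x| + r) - Real.log 2 :=
      Real.log_div (by linarith) two_ne_zero
    have e2 : Real.log ρ = Real.log (|x| - r) - Real.log a := by
      rw [hρ]; exact Real.log_div (by linarith) ha.ne'
    have e3 : Real.log (|x| + r) + Real.log (|x| - r) = 2 * Real.log a := by
      rw [← Real.log_mul (by linarith) (by linarith),
        show (|x| + r) * (|x| - r) = a ^ 2 by nlinarith [sq_abs x], Real.log_pow]
      norm_num
    linarith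
  rw [hlog, smul_eq_mul, smul_eq_mul]
  ring

/-- **The equilibrium potential is minimal on the segment**: for `0 < a` and every real `x`,
`2π log (a/2) ≤ ∫_{-π}^{π} log |x - a cos β| dβ`. [folklore] -/
theorem twoPi_mul_log_half_le_integral_log_abs_sub_mul_cos {a : ℝ} (ha : 0 < a) (x : ℝ) :
    2 * π * Real.log (a / 2) ≤ ∫ β in (-π)..π, Real.log |x - a * Real.cos β| := by
  rcases le_or_gt |x| a with hx | hx
  · rw [integral_log_abs_sub_mul_cos_of_abs_le ha hx]
  · rw [integral_log_abs_sub_mul_cos_of_lt_abs ha hx]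
    refine mul_le_mul_of_nonneg_left (Real.log_le_log (by positivity) ?_) (by positivity)
    have := Real.sqrt_nonneg (x ^ 2 - a ^ 2)
    linarith

/-- Integrability of `β ↦ log |x - a cos β|` on `[-π, π]` (`a > 0`). [folklore] -/
theorem intervalIntegrable_log_abs_sub_mul_cos {a : ℝ} (ha : 0 < a) (x : ℝ) :
    IntervalIntegrable (fun β => Real.log |x - a * Real.cos β|) volume (-π) π := by
  rcases le_or_gt |x| a with hx | hx
  · exact intervalIntegrable_log_abs_sub_mul_cos_of_abs_le ha hx _ _
  · -- off the segment: continuous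
    refine (Continuous.continuousOn ?_).intervalIntegrable
    refine Continuous.log (by fun_prop) fun β => ?_
    have h1 : |a * Real.cos β| ≤ a := by
      rw [abs_mul, abs_of_pos ha]
      exact mul_le_of_le_one_right ha.le (Real.abs_cos_le_one β)
    intro h0
    rw [abs_eq_zero, sub_eq_zero] at h0
    rw [h0] at hx
    exact absurd h1 (not_le.mpr hx)

/-! ### The distribution-function parametrisation `y = a sin (π s/2)`, `s ∈ [-1, 1]` -/

/-- Change of variables `β = π/2 - (π/2) s`:
`∫_{-1}^{1} F (sin (π s/2)) ds = π⁻¹ ∫_{-π}^{π} F (cos β) dβ` whenever `β ↦ F (cos β)` is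
integrable on `[-π, π]` (only `[0, π]` is used, twice, by evenness). [folklore] -/
theorem integral_comp_sin_pi_div_two_mul {F : ℝ → ℝ}
    (hF : IntervalIntegrable (fun β => F (Real.cos β)) volume (-π) π) :
    ∫ s in (-1 : ℝ)..1, F (Real.sin (π / 2 * s)) = π⁻¹ * ∫ β in (-π)..π, F (Real.cos β) := by
  have hπ0 := Real.pi_pos
  have hπ : (-(π / 2) : ℝ) ≠ 0 := by intro h; linarith
  have h1 : (∫ s in (-1 : ℝ)..1, F (Real.sin (π / 2 * s))) =
      ∫ s in (-1 : ℝ)..1, (fun β => F (Real.cos β)) (-(π / 2) * s + π / 2) := by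
    refine intervalIntegral.integral_congr fun s _ => ?_
    simp only [neg_mul, show -(π / 2 * s) + π / 2 = π / 2 - π / 2 * s by ring,
      Real.cos_pi_div_two_sub]
  rw [h1, intervalIntegral.integral_comp_mul_add (fun β => F (Real.cos β)) hπ (π / 2),
    show -(π / 2) * (-1 : ℝ) + π / 2 = π by ring, show -(π / 2) * (1 : ℝ) + π / 2 = 0 by ring,
    intervalIntegral.integral_symm, smul_eq_mul]
  -- evenness: `∫_{-π}^{π} F(cos β) = 2 ∫_0^π F(cos β)`
  have hsub1 : uIcc (-π) 0 ⊆ uIcc (-π) π := by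
    rw [uIcc_of_le (by linarith), uIcc_of_le (by linarith)]
    exact Icc_subset_Icc le_rfl hπ0.le
  have hsub2 : uIcc 0 π ⊆ uIcc (-π) π := by
    rw [uIcc_of_le hπ0.le, uIcc_of_le (by linarith)]
    exact Icc_subset_Icc (by linarith) le_rfl
  have hsplit := intervalIntegral.integral_add_adjacent_intervals (hF.mono_set hsub1)
    (hF.mono_set hsub2)
  have hneg : (∫ β in (-π)..0, F (Real.cos β)) = ∫ β in (0:ℝ)..π, F (Real.cos β) := by
    have h := intervalIntegral.integral_comp_neg (a := (0:ℝ)) (b := π) (fun β => F (Real.cos β))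
    simp only [Real.cos_neg, neg_zero] at h
    rw [← h]
  rw [← hsplit, hneg]
  field_simp
  ring

/-- **The arcsine potential in the distribution-function variable**: for `0 < a`, `|x| ≤ a`,
`∫_{-1}^{1} log |x - a sin (π s/2)| ds = 2 log (a/2)`. With `a = 2√N` this is the identity
`∫ log |x - y| Ω_N''(y) dy = log N` on `[-2√N, 2√N]` for the Logan–Shepp–Vershik–Kerov shape.
[folklore] -/
theorem integral_log_abs_sub_mul_sin {x a : ℝ} (ha : 0 < a) (hx : |x| ≤ a) :
    ∫ s in (-1 : ℝ)..1, Real.log |x - a * Real.sin (π / 2 * s)| = 2 * Real.log (a / 2) := by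
  rw [integral_comp_sin_pi_div_two_mul (F := fun y => Real.log |x - a * y|)
      (intervalIntegrable_log_abs_sub_mul_cos ha x),
    integral_log_abs_sub_mul_cos_of_abs_le ha hx]
  field_simp

/-- For `0 < a` and every real `x`: `2 log (a/2) ≤ ∫_{-1}^{1} log |x - a sin (π s/2)| ds`.
[folklore] -/
theorem two_mul_log_half_le_integral_log_abs_sub_mul_sin {a : ℝ} (ha : 0 < a) (x : ℝ) :
    2 * Real.log (a / 2) ≤ ∫ s in (-1 : ℝ)..1, Real.log |x - a * Real.sin (π / 2 * s)| := by
  rw [integral_comp_sin_pi_div_two_mul (F := fun y => Real.log |x - a * y|)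
      (intervalIntegrable_log_abs_sub_mul_cos ha x)]
  have h := twoPi_mul_log_half_le_integral_log_abs_sub_mul_cos ha x
  rw [le_inv_mul_iff₀ Real.pi_pos]
  linarith

end Literature.Analysis.Potential

end
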